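import Literature.AnabelianGeometry.SemiGraphs.PSCAuxiliaryCoveringsSmoothCurve
import Literature.AnabelianGeometry.SemiGraphs.PSCSmoothCurveGenuineCuspidal
import HarnessLib

/-!
# [CombGC] Rmk. 1.4.3 (2007 text; FACT-LIST row F-0466) DECIDED at the pro-`ℓ` genuine smooth-curve origin, conjunct by conjunct

Mochizuki, *A combinatorial version of the Grothendieck conjecture*, Tohoku Math. J. **59** (2007)
[CombGC], Rmk. 1.4.3 p. 12 (auxiliary coverings: for `G' → G` as in Rmk. 1.4.2, cuspidally / nodally /
verticially totally ramified and connected over `e`, "There exists a finite étale `Π_G`- (resp. `Π_G`-;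
`Π^unr_G`-) covering `G'' → G` such that: (a) `G'' → G` is trivial over `G_e`; (b) the subcovering
`G''' → G''` … is cuspidally (resp. nodally; verticially) purely totally ramified"), typed verbatim by
abc-iut-L3-t4 as `CuspidalAuxiliaryCoveringExists ∧ NodalAuxiliaryCoveringExists ∧
VerticialAuxiliaryCoveringExists` under the origin schema `AuxiliaryCoveringsExistHolds Ω` (row F-0466);
Def. 1.4 (v) p. 11; and the author's correction [IUTchI] Rmk. 1.2.3 (i)(ii) pp. 41–43 ("the cuspidal and
nodal cases of the notion of a purely totally ramified covering are in fact unnecessary and may be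
deleted"). [cite: MochizukiCombGC2007, Rmk 1.4.3 p.12] [cite: MochizukiCombGC2007, Def 1.4(v) p.11]
[cite: Mochizuki2012, IUTchI Rmk 1.2.3(ii) p.41]

PROOF-ONLY file (abc-iut cell, layer L3, L-F sub-cell [SemiAnbd]+[CombGC] pack C, row «F-0466 at Ω_scg
and the two-component origins», seat abc-iut-w5-d174 gen 5), building on abc-iut-L3-t4's finding
F-L3t4g5-2 (`PSCAuxiliaryCoveringsSmoothCurve.lean`: (a) forces every cusp / vertex of `G''` over `e` to
be totally ramified in `G''' → G''`, so "purely" forces `G'' = G`; structural lemmas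
`smul_cuspGp_le_of_cuspidalAuxiliaryCoveringExists`, `smul_vertGp_le_of_verticialAuxiliaryCoveringExists`,
and the tripod counter-datum).  Here the row is decided CONJUNCT BY CONJUNCT at the first of the two genuine
carriers the tree now has (the second, the two-component origin, in the companion file):

* positive instances: `cuspidalAuxiliaryCoveringExists_of_isEmpty` (no cusps),
  `nodalAuxiliaryCoveringExists_of_isEmpty` (no nodes), `nodalAuxiliaryCoveringExists_of_subsingleton`
  (at most one node: `G'' := G` works), `verticialAuxiliaryCoveringExists_of_vertGp_eq_top` (one vertex
  with `Π_v = Π`), `verticialAuxiliaryCoveringExists_of_not_isSturdy` (guard);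
* `not_cuspidalAuxiliaryCoveringExists_of_smoothCurve'` — the cuspidal conjunct FAILS at every
  smooth-curve datum with two cusps whose cusp groups are ANY conjugates of the closed cusp inertia
  groups (abc-iut-w5-d195's relaxed clause), via the cusp character `c ↦ 1`, `c' ↦ −1`;
* `not_auxiliaryCoveringsExistHolds_of_smoothCurveGenuine` — hence **`¬ AuxiliaryCoveringsExistHolds Ω`
  at the pro-`ℓ` genuine smooth-curve origin** `Ω_scg^{(ℓ)}` (any origin admitting the pro-`ℓ` tripod),
  while its nodal and verticial conjuncts hold at every datum there
  (`nodal_and_verticialAuxiliaryCoveringExists_of_smoothCurveGenuine`);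
* the two-component origin (verticial conjunct refuted at sturdy data, `¬ AuxiliaryCoveringsExistHolds Ω_tc`)
  is the companion file `PSCAuxiliaryCoveringsTwoComponent.lean`.

0 definitions.  A kernel decision of OUR typed 2007 statement at genuine data, consistent with the
author's 2012 withdrawal of it; nothing here concerns the corrected statements ([IUTchI] Rmk. 1.2.3
(iv)(v), typed separately), and nothing here takes a side on [IUTchIII] Cor. 3.12.
-/

noncomputable section

namespace Literature.AnabelianGeometry.SemiGraphs

namespace PSCDatum

open scoped Pointwise
open Multiplicative
open Literature.GroupTheory.CombinatorialGroupTheory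
open Literature.GroupTheory.CombinatorialGroupTheory.PuncturedSurfaceGroup (cuspInertia IsHyperbolicType)
open Literature.AnabelianGeometry.Anabelioids (IsSigmaInteger)
open SemiGraphOfAnabelioids (IsProSigmaCompletion)
open SemiGraphOfAnabelioids.IsProSigmaCompletion (exists_isProSigmaCompletion)

universe u

variable {P : Type u} [Group P] [TopologicalSpace P] [IsTopologicalGroup P]

/-! ### Positive instances of the three conjuncts -/

section Positive

variable (G : PSCDatum P)

omit [IsTopologicalGroup P] in
/-- No cusps: the cuspidal case of [CombGC] Rmk. 1.4.3 is vacuous. [cite: MochizukiCombGC2007, Rmk 1.4.3 p.12] -/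
theorem cuspidalAuxiliaryCoveringExists_of_isEmpty [IsEmpty G.graph.C] :
    G.CuspidalAuxiliaryCoveringExists := fun _ _ _ c => isEmptyElim c

omit [IsTopologicalGroup P] in
/-- No nodes: the nodal case of [CombGC] Rmk. 1.4.3 is vacuous. [cite: MochizukiCombGC2007, Rmk 1.4.3 p.12] -/
theorem nodalAuxiliaryCoveringExists_of_isEmpty [IsEmpty G.graph.N] :
    G.NodalAuxiliaryCoveringExists := fun _ _ _ e => isEmptyElim e

omit [IsTopologicalGroup P] in
/-- At most one node: the nodal case of [CombGC] Rmk. 1.4.3 holds with `G'' := G` — the pulled-back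
covering is `G' → G` itself, totally ramified at the node by hypothesis, and there is no other node
(every `γ'` lies in the double coset `Π · γ · Π_e`). [cite: MochizukiCombGC2007, Rmk 1.4.3 p.12] -/
theorem nodalAuxiliaryCoveringExists_of_subsingleton [Subsingleton G.graph.N] :
    G.NodalAuxiliaryCoveringExists := by
  intro l k H' e γ _ hN hO _ htot
  refine ⟨⊤, by rw [Subgroup.coe_top]; exact isOpen_univ, le_top, ?_, e, γ, ?_, fun e' γ' h => ?_⟩
  · rw [top_inf_eq]; exact isGaloisCovering_top hO
  · rw [top_inf_eq, top_inf_eq]; exact htot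
  · exact (h.elim (fun hne => hne (Subsingleton.elim _ _))
      (fun hmem => hmem (mem_doubleCoset_top _ _ _))).elim

/-- One vertex with `Π_v = Π`: the verticial case of [CombGC] Rmk. 1.4.3 holds with `G'' := G`
(abc-iut-L3-t4's smooth-proper argument, which does not use the absence of cusps).
[cite: MochizukiCombGC2007, Rmk 1.4.3 p.12] -/
theorem verticialAuxiliaryCoveringExists_of_vertGp_eq_top (hV : ∀ v, G.vertGp v = ⊤) (v₀ : G.graph.V)
    (hv : ∀ w, w = v₀) : G.VerticialAuxiliaryCoveringExists := by
  intro _ l k H' v γ _ hN hO _ _ _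
  refine ⟨⊤, by rw [Subgroup.coe_top]; exact isOpen_univ, le_top, le_top, ?_, v, γ, ?_,
    fun v' γ' h => ?_⟩
  · rw [top_inf_eq]; exact isGaloisCovering_top hO
  · rw [hV, conjAct_smul_top, top_inf_eq, top_sup_eq]
  · exact (h.elim (fun hne => hne (by rw [hv v, hv v']))
      (fun hmem => hmem (mem_doubleCoset_top _ _ _))).elim

/-- The verticial case of [CombGC] Rmk. 1.4.3 is stated for sturdy `G` only: vacuous otherwise.
[cite: MochizukiCombGC2007, Rmk 1.4.3 p.12] -/
theorem verticialAuxiliaryCoveringExists_of_not_isSturdy (h : ¬ G.IsSturdy) :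
    G.VerticialAuxiliaryCoveringExists := fun hst => absurd hst h

/-- The verticial case of [CombGC] Rmk. 1.4.3 quantifies over `Σ = {l}`: vacuous when `Σ` is not a
singleton. [cite: MochizukiCombGC2007, Rmk 1.4.3 p.12] -/
theorem verticialAuxiliaryCoveringExists_of_sigma_ne (h : ∀ l : ℕ, G.Sigma ≠ {l}) :
    G.VerticialAuxiliaryCoveringExists := fun _ l _ _ _ _ hS => absurd hS (h l)

end Positive

/-! ### A subgroup meeting a character of prime order nontrivially supplements its kernel -/

omit [TopologicalSpace P] [IsTopologicalGroup P] in
/-- If `χ : Π → ℤ/ℓ` (`ℓ` prime) takes the value `1` on some element of `K`, then `K · Ker χ = Π`.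
[folklore] -/
private theorem sup_ker_eq_top_of_apply_eq {ℓ : ℕ} [Fact (1 < ℓ)] (hℓ : ℓ.Prime)
    (χ : P →* Multiplicative (ZMod ℓ)) (K : Subgroup P) {x : P} (hx : x ∈ K) (hχx : χ x = ofAdd 1) :
    K ⊔ χ.ker = ⊤ := by
  haveI : Fact (Nat.card (Multiplicative (ZMod ℓ))).Prime :=
    ⟨by rw [show Nat.card (Multiplicative (ZMod ℓ)) = ℓ from Nat.card_zmod ℓ]; exact hℓ⟩
  have hmap : (K ⊔ χ.ker).map χ = ⊤ := by
    refine ((K ⊔ χ.ker).map χ).eq_bot_or_eq_top_of_prime_card.resolve_left fun hbot => ?_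
    have hmem : χ x ∈ (K ⊔ χ.ker).map χ := Subgroup.mem_map_of_mem χ (Subgroup.mem_sup_left hx)
    rw [hbot, Subgroup.mem_bot, hχx] at hmem
    exact one_ne_zero (ofAdd_eq_one.mp hmem)
  have h := Subgroup.comap_map_eq χ (K ⊔ χ.ker)
  rw [hmap, Subgroup.comap_top, sup_assoc, sup_idem] at h
  exact h.symm

omit [TopologicalSpace P] [IsTopologicalGroup P] in
/-- The kernel of a character `Π → ℤ/ℓ` (`ℓ` prime) taking the value `1` has index `ℓ`. [folklore] -/
private theorem index_ker_eq_of_apply_eq {ℓ : ℕ} [Fact (1 < ℓ)] (hℓ : ℓ.Prime)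
    (χ : P →* Multiplicative (ZMod ℓ)) {x : P} (hχx : χ x = ofAdd 1) : χ.ker.index = ℓ := by
  haveI : Fact (Nat.card (Multiplicative (ZMod ℓ))).Prime :=
    ⟨by rw [show Nat.card (Multiplicative (ZMod ℓ)) = ℓ from Nat.card_zmod ℓ]; exact hℓ⟩
  have hrange : χ.range = ⊤ := by
    refine χ.range.eq_bot_or_eq_top_of_prime_card.resolve_left fun hbot => ?_
    have hmem : χ x ∈ χ.range := ⟨x, rfl⟩
    rw [hbot, Subgroup.mem_bot, hχx] at hmem
    exact one_ne_zero (ofAdd_eq_one.mp hmem)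
  rw [Subgroup.index_ker, hrange, Subgroup.card_top]
  exact Nat.card_zmod ℓ

/-! ### The cuspidal conjunct at smooth-curve data with conjugate cusp representatives (two cusps) -/

section SmoothCurve

variable [CompactSpace P] [TotallyDisconnectedSpace P]

/-- **The typed [CombGC] Rmk. 1.4.3 (cuspidal case) FAILS at every smooth-curve datum with two distinct
cusps, cusp groups ANY conjugates of the closed cusp inertia groups** (abc-iut-w5-d195's relaxed cusp
clause; `Σ = {ℓ}`, a profinite pro-`Σ` completion `ι : Γ_{g,r} → Π`): the cusp character `c ↦ 1`,
`c' ↦ −1` extends continuously to `Π`; its kernel is a normal open subgroup of index `ℓ` at which `c` is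
totally ramified, so abc-iut-L3-t4's `smul_cuspGp_le_of_cuspidalAuxiliaryCoveringExists` would put
`Π_{c'}` inside it — but the character is `−1 ≠ 0` on a generator of `Π_{c'}`.
[cite: MochizukiCombGC2007, Rmk 1.4.3 p.12] -/
theorem not_cuspidalAuxiliaryCoveringExists_of_smoothCurve' (G : PSCDatum P) {ℓ g r : ℕ}
    (hSig : G.Sigma = {ℓ}) (ι : PuncturedSurfaceGroup g r →* P) (hι : IsProSigmaCompletion G.Sigma ι)
    (e : G.graph.C ≃ Fin r)
    (hC : ∀ c, ∃ δ : ConjAct P, G.cuspGp c = δ • ((cuspInertia (g := g) (e c)).map ι).topologicalClosure)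
    {c c' : G.graph.C} (hcc : c' ≠ c) : ¬ G.CuspidalAuxiliaryCoveringExists := by
  classical
  intro hAux
  have hl : ℓ.Prime := G.prime_of_sigma_eq hSig
  haveI : Fact (1 < ℓ) := ⟨hl.one_lt⟩
  -- the cusp character `c ↦ 1`, `c' ↦ -1`
  let w : Fin r → ZMod ℓ := fun k => (if k = e c then 1 else 0) + (if k = e c' then -1 else 0)
  have hee : e c' ≠ e c := fun h' => hcc (e.injective h')
  have hw : ∑ k, w k = 0 := by
    simp only [w, Finset.sum_add_distrib, Finset.sum_ite_eq', Finset.mem_univ, if_true]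
    exact add_neg_cancel 1
  obtain ⟨φ, hφ⟩ := PuncturedSurfaceGroup.exists_cuspCharacter (g := g) w hw
  have hφc : φ (PuncturedSurfaceGroup.c (e c)) = ofAdd 1 := by
    rw [hφ]; simp [w, Ne.symm hee]
  have hφc' : φ (PuncturedSurfaceGroup.c (e c')) = ofAdd (-1) := by
    rw [hφ]; simp [w, hee]
  have hcard : IsSigmaInteger G.Sigma (Nat.card (Multiplicative (ZMod ℓ))) := by
    rw [show Nat.card (Multiplicative (ZMod ℓ)) = ℓ from Nat.card_zmod ℓ, hSig]
    exact ⟨hl.pos, fun p hp hpl => (Nat.prime_dvd_prime_iff_eq hp hl).mp hpl⟩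
  obtain ⟨χ, hχc, hχ⟩ := hι.exists_continuous_extend_top hcard φ
  -- conjugation does not change the value of `χ`
  have hconj : ∀ (δ : ConjAct P) (x : P), χ (δ • x) = χ x := fun δ x => by
    rw [ConjAct.smul_def, map_mul, map_mul, map_inv, mul_inv_cancel_comm]
  -- generators of the two cusp groups and their values
  obtain ⟨δ, hδ⟩ := hC c
  obtain ⟨δ', hδ'⟩ := hC c'
  have hx : δ • ι (PuncturedSurfaceGroup.c (e c)) ∈ G.cuspGp c := by
    rw [hδ]
    refine Subgroup.smul_mem_pointwise_smul _ _ _ ?_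
    rw [PuncturedSurfaceGroup.cuspInertia, MonoidHom.map_zpowers]
    exact Subgroup.le_topologicalClosure _ (Subgroup.mem_zpowers _)
  have hx' : δ' • ι (PuncturedSurfaceGroup.c (e c')) ∈ G.cuspGp c' := by
    rw [hδ']
    refine Subgroup.smul_mem_pointwise_smul _ _ _ ?_
    rw [PuncturedSurfaceGroup.cuspInertia, MonoidHom.map_zpowers]
    exact Subgroup.le_topologicalClosure _ (Subgroup.mem_zpowers _)
  have hχx : χ (δ • ι (PuncturedSurfaceGroup.c (e c))) = ofAdd 1 := by rw [hconj, hχ, hφc]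
  have hχx' : χ (δ' • ι (PuncturedSurfaceGroup.c (e c'))) = ofAdd (-1) := by rw [hconj, hχ, hφc']
  -- `H' := Ker χ`: normal, open, of index `ℓ`, totally ramified at `c`
  have hO : IsOpen (χ.ker : Set P) := (isOpen_discrete ({1} : Set _)).preimage hχc
  have hidx : χ.ker.index = ℓ := index_ker_eq_of_apply_eq hl χ hχx
  have htot : (1 : ConjAct P) • G.cuspGp c ⊔ χ.ker = ⊤ := by
    rw [one_smul]
    exact sup_ker_eq_top_of_apply_eq hl χ (G.cuspGp c) hx hχx
  -- the structural consequence puts `Π_{c'}` inside `Ker χ`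
  have hle := G.smul_cuspGp_le_of_cuspidalAuxiliaryCoveringExists hAux hSig hO hidx htot hcc 1
  rw [one_smul] at hle
  have h1 : χ (δ' • ι (PuncturedSurfaceGroup.c (e c'))) = 1 := hle hx'
  rw [hχx'] at h1
  exact one_ne_zero (neg_eq_zero.mp (ofAdd_eq_one.mp h1))

omit [CompactSpace P] [TotallyDisconnectedSpace P] in
/-- **At a genuine smooth-curve datum the nodal and verticial conjuncts of row F-0466 hold** (no nodes;
one vertex with `Π_v = Π`). [cite: MochizukiCombGC2007, Rmk 1.4.3 p.12] -/
theorem nodal_and_verticialAuxiliaryCoveringExists_of_smoothCurveGenuine (G : PSCDatum P)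
    [IsEmpty G.graph.N] (hV : ∀ v, G.vertGp v = ⊤) (v₀ : G.graph.V) (hv : ∀ w, w = v₀) :
    G.NodalAuxiliaryCoveringExists ∧ G.VerticialAuxiliaryCoveringExists :=
  ⟨G.nodalAuxiliaryCoveringExists_of_isEmpty, G.verticialAuxiliaryCoveringExists_of_vertGp_eq_top hV v₀ hv⟩

end SmoothCurve

/-! ### Row F-0466 at the pro-`ℓ` genuine smooth-curve origin -/

/-- **`¬ AuxiliaryCoveringsExistHolds Ω` at the pro-`ℓ` genuine smooth-curve origin** (and at every
origin admitting the pro-`ℓ` tripod with its exact cusp representatives): for `ℓ` prime, let `Ω` declare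
"of PSC-type" (at least) every datum of abc-iut-w5-d195's pro-`ℓ` genuine smooth-curve shape (`hin`;
verbatim the `let Ω` of `exists_smoothCurveGenuineProLOrigin_allInputs_hold`).  The tripod
`Γ_{0,3} → Π` (pro-`ℓ` completion, three cusps `closure ι⟨c_i⟩`) is such a datum, and the cuspidal
conjunct of [CombGC] Rmk. 1.4.3 (2007 text) fails at it (abc-iut-L3-t4's
`not_cuspidalAuxiliaryCoveringExists_of_smoothCurve`). [cite: MochizukiCombGC2007, Rmk 1.4.3 p.12] -/
theorem not_auxiliaryCoveringsExistHolds_of_smoothCurveGenuine (ℓ : ℕ) (hℓ : ℓ.Prime) (Ω : PSCOrigin.{0})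
    (hin : ∀ ⦃Q : Type⦄ [Group Q] [TopologicalSpace Q] (G : PSCDatum Q),
      (∃ (_ : IsTopologicalGroup Q), CompactSpace Q ∧ T2Space Q ∧
        TotallyDisconnectedSpace Q ∧ IsEmpty G.graph.N ∧ (∀ v, G.vertGp v = ⊤) ∧
        (∃ v₀ : G.graph.V, ∀ w, w = v₀) ∧ G.Sigma = {ℓ} ∧
        ∃ (g r : ℕ) (ι : PuncturedSurfaceGroup g r →* Q) (e : G.graph.C ≃ Fin r),
          IsHyperbolicType g r ∧ IsProSigmaCompletion G.Sigma ι ∧ (∀ v, G.genus v = g) ∧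
          ∀ c, ∃ δ : ConjAct Q, G.cuspGp c =
            δ • ((cuspInertia (g := g) (e c)).map ι).topologicalClosure) → Ω.IsOfPSCType G) :
    ¬ Literature.AnabelianGeometry.SemiGraphs.PSCDatum.AuxiliaryCoveringsExistHolds Ω := by
  -- the pro-`ℓ` tripod (adapted from abc-iut-w5-d195's inhabitant of the smooth-curve origin)
  obtain ⟨Q, η, hη⟩ := exists_isProSigmaCompletion (PuncturedSurfaceGroup 0 3) ({ℓ} : Set ℕ)
  let T : PSCDatum Q :=
    { Sigma := {ℓ}
      sigma_prime := fun p hp => by rw [Set.mem_singleton_iff.mp hp]; exact hℓ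
      sigma_nonempty := ⟨ℓ, Set.mem_singleton ℓ⟩
      graph := { V := Unit, N := Empty, C := Fin 3, nodeEnds := Empty.elim, cuspEnd := fun _ => () }
      vertGp := fun _ => ⊤
      nodeGp := Empty.elim
      cuspGp := fun i => ((cuspInertia (g := 0) i).map η).topologicalClosure
      genus := fun _ => 0
      isClosed_vertGp := fun _ => by rw [Subgroup.coe_top]; exact isClosed_univ
      isClosed_nodeGp := fun e => e.elim
      isClosed_cuspGp := fun _ => Subgroup.isClosed_topologicalClosure _
      nodeGp_le := fun e => e.elim
      cuspGp_le := fun _ => ⟨1, le_top⟩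
      proSigma := isProSigma_of_isProSigmaCompletion hη }
  have hT : Ω.IsOfPSCType T :=
    hin T ⟨inferInstance, inferInstance, inferInstance, inferInstance, inferInstanceAs (IsEmpty Empty),
      fun _ => rfl, ⟨(), fun _ => rfl⟩, rfl, 0, 3, η, Equiv.refl _,
      (by unfold IsHyperbolicType; norm_num), hη, fun _ => rfl,
      fun c => ⟨1, by rw [one_smul]; rfl⟩⟩
  intro h
  exact not_cuspidalAuxiliaryCoveringExists_of_smoothCurve hℓ η hη T rfl (Equiv.refl _) (fun _ => rfl)
    (c := (0 : Fin 3)) (c' := (1 : Fin 3)) (Fin.ne_of_val_ne (by decide)) (h T hT).1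

end PSCDatum

end Literature.AnabelianGeometry.SemiGraphs

end
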